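import Mathlib
import Summits.ResolutionOfSingularities.ResolutionOfSingularities.Theorems.WeightedInvariantContactCentreFiltrationBasic
import Summits.ResolutionOfSingularities.ResolutionOfSingularities.Theorems.WeightedInvariantHypersurfaceLocalGameEFTDimTwoContact
import HarnessLib

/-!
# The intrinsic centre filtration `jContact` (door `HypersurfaceCentreConstruction`, stmt-ResolutionOfSingularities-19897,
# rung P2) on REGULAR local rings: CASE A, the DVR positions (P1 agreement), CASE B = canonicity, and `b_max` IS ATTAINED
# (boundedness of the reached contact levels in an EXCELLENT regular local ring, K6)

Topic: `Summits/ResolutionOfSingularities/ResolutionOfSingularities/Theorems`. Helper for the door item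
`HypersurfaceCentreConstruction` (statement `stmt-ResolutionOfSingularities-19897`, route `WeightedInvariant`), line
`local-engine` of res-L1-w43-plan-1 (L W4.3), ORDER **(o24-D)** targets `jContact_of_eq_unit_mul_pow`,
`jContact_eq_pow_of_DVR`, `jContact_eq_contactFiltration`, `one_le_bMax_and_reaches` — the last in the generality fixed by
res-type-092's DESIGN (R2) 08:06:47Z = plan-1 AMENDMENT v1.1 (C) 08:05:47Z = res-type-070 INPUT 08:02:30Z = res-type-078
REVIEW (2) 08:05:35Z: the planner sketch's hypothesis `ringKrullDim R = 2` is REPLACED by EXCELLENCE.  Third file of the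
(o24-D) triple (defs `…ContactCentreFiltration`, local-ring theory `…ContactCentreFiltrationBasic`).  Typer res-type-092.

[OURS · L1 W4.3] Replaces the role of NO printed item; NOT a statement of the manuscript
[claim: Hironaka2017, status: under-review]. AI work, weaker than expert review.

## Contents (sorry-free, standard axioms; no definitions)

* **CASE A `jContact_of_eq_unit_mul_pow`**: `f = v g^ν`, `ν ≥ 1`, regular local ring (any dimension) ⇒ `J = (g)^m`
  (`radical_span_unit_mul_pow`: `√(v g^ν) = (g)`, `g` prime by Matsumura 14.3);
* **P1 agreement `jContact_eq_pow_of_DVR`**: `J = 𝔪^m` at the non-zero non-units of a DVR — EXACTLY the hypothesis `hJ` of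
  `canonicalGameClause_dimOne_of_isoInvariant` (p510636) / `jOpenPresentationForallSing_dimOne_of_isMaximal` (p511512);
* **CASE B `jContact_eq_contactFiltration`**: in a regular local ring (any dimension, no excellence), for `f ≠ 0` not of
  monomial type and ANY `g ∈ 𝔪 ∖ 𝔪²` carrying `f` to the terminal level, `J = contactFiltration g (bMax f)` — res-type-078's
  CANONICITY C2 `contactFiltration_eq_of_mem` (`bMax ≥ 2`), `contactFiltration_one_weight` (`bMax = 1`),
  `contactFiltration_zero_weight` (junk `bMax = 0`); `weightedMonomialIdeal_eq_jContact` — the same in the coordinates of a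
  move `u = (x, g)`, `w = (1, b_max)` (the literal (pres) conjunct for res-type-098's (o24-G));
* `bddAbove_reaches` — in an EXCELLENT regular local ring (every dimension), at `0 ≠ f ∈ 𝔪²` NOT of monomial type the set
  of reached levels `{b ≥ 1 | Reaches f (ord f) b}` is bounded.  Proof: otherwise every level `k + 2` is reached by some
  `g_k ∈ 𝔪 ∖ 𝔪²`; the key step of res-type-078's canonicity (`mem_span_sup_pow_of_mem_contactFiltration`: two parameters
  reaching the same level `b ≥ 2` differ by a unit and an element of `𝔪^b`) RECTIFIES the `g_k` by units into an `𝔪`-adic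
  steepening sequence `y_{k+1} - y_k ∈ 𝔪^{k+2}` with `f ∈ (y_k^ν) + 𝔪^{k+2}` (`contactFiltration_level_le_span_pow_sup_pow`), and
  K6 = res-type-078's `LocalGameEFTContact.exists_associated_pow_of_adicSteepening` (termination of steepening, excellence)
  makes `f` a unit times `π^ν`, i.e. of monomial type — contradiction;
* **`one_le_bMax_and_reaches`** `(hS : IsExcellentRing R)`: `1 ≤ bMax f ∧ Reaches f (ord f) (bMax f)` (`Nat.sSup_mem`;
  level `1` is reached by any regular parameter); `one_le_bMax_and_reaches_of_essFiniteType` — the binder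
  `[Algebra k₀ R] [Algebra.EssFiniteType k₀ R]` of the door's positions (`IsExcellentRing.of_essFiniteType`);
  `le_bMax_of_reaches`, **`not_reaches_of_bMax_lt`** / `not_mem_contactFiltration_of_bMax_lt` (NO parameter carries `f`
  above `b_max` — res-type-078's export (ii), the CASE-B trigger of res-type-098's (o24-G)).

WHY EXCELLENCE (res-type-070's witness, 08:02:30Z; design note (R2)): for Nagata's non-excellent DVR `V = k^p[[x]][k]`
(`[k : k^p] = ∞`, `V̂ = k[[x]]`), `R = V[y]_(x,y)` and `f = y^p - d^p` with `d ∈ x k[[x]] ∖ V`, `d^p ∈ V`: `f` is prime of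
order `p ≥ 2` in `R` (not of monomial type) but `y - (d mod x^k)` carries `f` to level `k` for EVERY `k` — the levels are
unbounded, `bMax f = sSup = 0`, and the bare statement fails (maximal contact exists only in `R̂ = k[[x,y]]`, `f = (y-d)^p`).

## References

* H. Matsumura, *Commutative Ring Theory*, Thm. 8.11, 11.2, 14.3, 20.3, §32 (excellent rings). [Matsumura1987]
* V. Cossart, U. Jannsen, S. Saito, *Desingularization: invariants and strategy*, LNM 2270 (2020), Ch. 8. [CossartJannsenSaito2020]
* res-L1-w43-plan-1, `CRUX-PLAN.md` §v8, `p2_jdef_sketch_v1_1.lean` (OURS, AI planning).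
-/

noncomputable section

open IsLocalRing Literature.AlgebraicGeometry.Resolution
open Summit.ResolutionOfSingularities.ResolutionOfSingularities.Theorems

set_option linter.dupNamespace false -- mandated namespace of this single-conjunct summit

namespace Summit.ResolutionOfSingularities.ResolutionOfSingularities.Cruxes.HypersurfaceCentreConstruction.LocalEngine

universe u

variable {S : Type u} [CommRing S]

/-! ## The monomial-type branch in a regular local ring: CASE A and the DVR positions (P1) -/

section Regular

variable [IsRegularLocalRing S]

/-- `√(v g^ν) = (g)` for a unit `v`, a regular parameter `g` and `ν ≥ 1` (`g` is a prime element, Matsumura 14.3).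
[cite: Matsumura1987, Thm. 14.3] -/
theorem radical_span_unit_mul_pow {v g : S} (hv : IsUnit v) (hg : g ∈ maximalIdeal S)
    (hg' : g ∉ maximalIdeal S ^ 2) {ν : ℕ} (hν : 1 ≤ ν) :
    (Ideal.span {v * g ^ ν}).radical = Ideal.span {g} := by
  have hg0 : g ≠ 0 := by
    rintro rfl
    exact hg' (Ideal.zero_mem _)
  have hprime : (Ideal.span {g}).IsPrime :=
    (Ideal.span_singleton_prime hg0).mpr (IsRegularLocalRing.prime_of_not_mem_sq hg hg')
  rw [Ideal.span_singleton_mul_left_unit hv, ← Ideal.span_singleton_pow, Ideal.radical_pow _ (by omega),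
    hprime.radical]

end Regular

/-- **CASE A (every dimension): monomial type ⇒ `J = (g)^m`.** For `f = v g^ν` with `v` a unit, `g ∈ 𝔪 ∖ 𝔪²` and
`ν ≥ 1` in a regular local ring, `jContact R f m = (g)^m` — the centre is the regular prime `(g)` (res-type-073's
`strat_of_eq_unit_mul_pow`). [OURS · L1 W4.3 · (o24-D)] -/
theorem jContact_of_eq_unit_mul_pow (R : Type u) [CommRing R] [IsRegularLocalRing R] {v g : R} (hv : IsUnit v)
    (hg : g ∈ maximalIdeal R) (hg' : g ∉ maximalIdeal R ^ 2) {ν : ℕ} (hν : 1 ≤ ν) (m : ℕ) :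
    jContact R (v * g ^ ν) m = Ideal.span {g} ^ m := by
  haveI := isDomain_of_isRegularLocalRing R
  have hg0 : g ≠ 0 := by
    rintro rfl
    exact hg' (Ideal.zero_mem _)
  have hf0 : v * g ^ ν ≠ 0 := mul_ne_zero hv.ne_zero (pow_ne_zero ν hg0)
  have hfu : ¬ IsUnit (v * g ^ ν) := fun h =>
    IsLocalRing.notMem_maximalIdeal.mpr h (Ideal.mul_mem_left _ v (Ideal.pow_mem_of_mem _ hg ν hν))
  have hmono : IsMonomialType (v * g ^ ν) := ⟨v, g, ν, hv, hg, hg', rfl⟩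
  rw [jContact_eq, jContactLocal_of_isMonomialType hf0 hfu hmono, radical_span_unit_mul_pow hv hg hg' hν]

/-- **Agreement with P1: at the non-zero non-units of a discrete valuation ring `J = 𝔪^m`** — EXACTLY the hypothesis
`hJ` of `canonicalGameClause_dimOne_of_isoInvariant` (p510636) and `jOpenPresentationForallSing_dimOne_of_isMaximal`
(p511512), so the dim-1 rung holds for `(iotaOrd, jContact)` by those theorems. (`g = u ϖ^k`, `k ≥ 1`, is of monomial
type and `(ϖ) = 𝔪`.) [OURS · L1 W4.3 · (o24-D)] -/
theorem jContact_eq_pow_of_DVR (R : Type u) [CommRing R] [IsDomain R] [IsDiscreteValuationRing R] (g : R)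
    (hg0 : g ≠ 0) (hg : g ∈ maximalIdeal R) (m : ℕ) : jContact R g m = maximalIdeal R ^ m := by
  obtain ⟨ϖ, hirr⟩ := IsDiscreteValuationRing.exists_irreducible R
  have h𝔪 : maximalIdeal R = Ideal.span {ϖ} := (IsDiscreteValuationRing.irreducible_iff_uniformizer ϖ).mp hirr
  obtain ⟨k, u, hgu⟩ := IsDiscreteValuationRing.eq_unit_mul_pow_irreducible hg0 hirr
  have hk : 1 ≤ k := by
    rcases Nat.eq_zero_or_pos k with rfl | hk
    · rw [pow_zero, mul_one] at hgu
      rw [hgu] at hg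
      exact (IsLocalRing.notMem_maximalIdeal.mpr u.isUnit hg).elim
    · exact hk
  have hϖ : ϖ ∈ maximalIdeal R := by
    rw [h𝔪]
    exact Ideal.mem_span_singleton_self ϖ
  have hϖ2 : ϖ ∉ maximalIdeal R ^ 2 := by
    rw [h𝔪, Ideal.span_singleton_pow, Ideal.mem_span_singleton]
    intro h
    have h1 : ϖ * ϖ ∣ ϖ * 1 := by rwa [mul_one, ← pow_two]
    exact hirr.not_isUnit (isUnit_of_dvd_one ((mul_dvd_mul_iff_left hirr.ne_zero).mp h1))
  rw [hgu, jContact_of_eq_unit_mul_pow R u.isUnit hϖ hϖ2 hk, h𝔪]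

/-! ## The contact branch in a regular local ring: `J = F_{g, b_max}` for ANY maximiser (CASE B, canonicity) -/

section Contact

variable [IsRegularLocalRing S]

/-- Off the monomial type, the order of `f ≠ 0` is a positive natural number `ν` with `f ∉ 𝔪^{ν+1}`, as soon as a regular
parameter exists. [folklore] -/
theorem exists_adicOrder_eq_of_not_isMonomialType {f : S} (hf0 : f ≠ 0) (hnm : ¬ IsMonomialType f)
    (hpar : ∃ g ∈ maximalIdeal S, g ∉ maximalIdeal S ^ 2) :
    ∃ ν : ℕ, adicOrder f = ν ∧ (adicOrder f).toNat = ν ∧ 1 ≤ ν ∧ f ∈ maximalIdeal S ^ ν ∧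
      f ∉ maximalIdeal S ^ (ν + 1) := by
  obtain ⟨ν, hν⟩ := ENat.ne_top_iff_exists.mp (adicOrder_ne_top hf0)
  have hford : f ∉ maximalIdeal S ^ (ν + 1) := (adicOrder_le_iff f ν).mp hν.symm.le
  have hfmem : f ∈ maximalIdeal S ^ ν := (le_adicOrder_iff f ν).mp hν.symm.ge
  refine ⟨ν, hν.symm, by rw [← hν]; rfl, ?_, hfmem, hford⟩
  by_contra h
  have hν0 : ν = 0 := by omega
  subst hν0
  rw [zero_add, pow_one, IsLocalRing.notMem_maximalIdeal] at hford
  obtain ⟨g, hg, hg'⟩ := hpar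
  exact hnm ⟨f, g, 0, hford, hg, hg', by rw [pow_zero, mul_one]⟩

/-- **CASE B: `J = F_{g, b_max}` for ANY maximiser `g`** (res-type-078's CANONICITY C2 `contactFiltration_eq_of_mem` for
`b_max ≥ 2`; `contactFiltration_one_weight` for `b_max = 1`; `contactFiltration_zero_weight` for the junk `b_max = 0`).
Valid in every regular local ring, no dimension or excellence hypothesis: whenever `g ∈ 𝔪 ∖ 𝔪²` carries `f` (`f ≠ 0`, not
of monomial type) to the terminal level, `jContact R f m = contactFiltration g (bMax f) m` for all `m`.
[OURS · L1 W4.3 · (o24-D)] -/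
theorem jContact_eq_contactFiltration (R : Type u) [CommRing R] [IsRegularLocalRing R] {f : R} (hf0 : f ≠ 0)
    (hnm : ¬ IsMonomialType f) {g : R} (hg : g ∈ maximalIdeal R) (hg' : g ∉ maximalIdeal R ^ 2)
    (hreach : f ∈ contactFiltration g (bMax f) (bMax f * (adicOrder f).toNat)) (m : ℕ) :
    jContact R f m = contactFiltration g (bMax f) m := by
  -- every maximiser defines the same filtration
  have key : ∀ g' : R, (g' ∈ maximalIdeal R ∧ g' ∉ maximalIdeal R ^ 2 ∧
      f ∈ contactFiltration g' (bMax f) (bMax f * (adicOrder f).toNat)) →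
      contactFiltration g' (bMax f) m = contactFiltration g (bMax f) m := by
    rintro g' ⟨hg'1, hg'2, hreach'⟩
    by_cases h0 : bMax f = 0
    · rw [h0, contactFiltration_zero_weight, contactFiltration_zero_weight]
    by_cases h1 : bMax f = 1
    · rw [h1, contactFiltration_one_weight hg'1, contactFiltration_one_weight hg]
    have hb : 2 ≤ bMax f := by omega
    obtain ⟨ν, -, hνeq, hν1, -, hford⟩ := exists_adicOrder_eq_of_not_isMonomialType hf0 hnm ⟨g, hg, hg'⟩
    rw [hνeq] at hreach hreach'
    exact ContactFiltration.contactFiltration_eq_of_mem hg'1 hg'2 hg hg' hb hν1 hford hreach' hreach m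
  have hfu : ¬ IsUnit f := fun hu => hnm ⟨f, g, 0, hu, hg, hg', by rw [pow_zero, mul_one]⟩
  rw [jContact_eq, jContactLocal_of_not_isMonomialType hf0 hfu hnm]
  refine le_antisymm (sup_le (pow_le_contactFiltration g _ m) (iSup₂_le fun g' hg'' => (key g' hg'').le)) ?_
  exact le_sup_of_le_right (le_iSup₂_of_le g ⟨hg, hg', hreach⟩ le_rfl)

/-- **(pres) for CASE B in coordinates**: with an r.s.p. `(x, g)` (`(x, g) = 𝔪`, `g ∉ 𝔪²`) whose second member carries
`f` (`f ≠ 0`, not of monomial type) to the terminal level `b_max ≥ 1`, the `(1, b_max)`-weighted filtration of the move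
`u = (x, g)`, `w = (1, b_max)` IS the centre filtration: `weightedMonomialIdeal ![x, g] ![1, bMax f] m = jContact R f m` —
the literal (pres) conjunct of `CanonicalGameClause(LE2)` for res-type-098's (o24-G) (C1
`weightedMonomialIdeal_eq_contactFiltration` + `jContact_eq_contactFiltration`). [OURS · L1 W4.3 · (o24-D)] -/
theorem weightedMonomialIdeal_eq_jContact (R : Type u) [CommRing R] [IsRegularLocalRing R] {f : R} (hf0 : f ≠ 0)
    (hnm : ¬ IsMonomialType f) {x g : R} (hxg : Ideal.span {x, g} = maximalIdeal R) (hg' : g ∉ maximalIdeal R ^ 2)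
    (hb : 1 ≤ bMax f) (hreach : f ∈ contactFiltration g (bMax f) (bMax f * (adicOrder f).toNat)) (m : ℕ) :
    weightedMonomialIdeal ![x, g] ![1, bMax f] m = jContact R f m := by
  have hg : g ∈ maximalIdeal R := hxg ▸ Ideal.subset_span (by simp)
  rw [ContactFiltration.weightedMonomialIdeal_eq_contactFiltration hxg hb, ← contactFiltration_def,
    jContact_eq_contactFiltration R hf0 hnm hg hg' hreach m]

end Contact

/-! ## `b_max` is attained: termination of steepening (K6) in an EXCELLENT regular local ring -/

section Terminal

variable [IsRegularLocalRing S]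

/-- The reached levels of a position NOT of monomial type are BOUNDED in an excellent regular local ring: otherwise every
level `k + 2` is reached by some `g_k`, the key step of canonicity (`mem_span_sup_pow_of_mem_contactFiltration`) rectifies
the `g_k` into an `𝔪`-adic steepening sequence `y_{k+1} - y_k ∈ 𝔪^{k+2}` with `f ∈ (y_k^ν) + 𝔪^{k+2}`, and K6
(`LocalGameEFTContact.exists_associated_pow_of_adicSteepening`) makes `f` a unit times `π^ν` — monomial type.
Without excellence this FAILS (Nagata's regular local rings with `f = y^p - c^p`, `c ∈ Ŝ ∖ S`). [OURS · L1 W4.3 · (o24-D)] -/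
theorem bddAbove_reaches (hS : IsExcellentRing S) {f : S} (hf0 : f ≠ 0) (hf2 : f ∈ maximalIdeal S ^ 2)
    (hnm : ¬ IsMonomialType f) :
    BddAbove {b : ℕ | 1 ≤ b ∧ Reaches f (adicOrder f).toNat b} := by
  -- a regular parameter exists (`𝔪 ≠ 0` since `0 ≠ f ∈ 𝔪`)
  have h𝔪 : maximalIdeal S ≠ ⊥ := by
    intro h
    apply hf0
    have : f ∈ maximalIdeal S := Ideal.pow_le_self two_ne_zero hf2
    rw [h] at this
    exact (Submodule.mem_bot S).mp this
  have hpar := exists_mem_maximalIdeal_not_mem_sq h𝔪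
  obtain ⟨ν, -, hνeq, hν1, -, hford⟩ := exists_adicOrder_eq_of_not_isMonomialType hf0 hnm hpar
  rw [hνeq]
  by_contra hT
  -- every level `b` is reached
  have hall : ∀ b : ℕ, Reaches f ν b := by
    intro b
    obtain ⟨b', ⟨-, hb'⟩, hbb'⟩ := not_bddAbove_iff.mp hT b
    exact hb'.of_le hbb'.le
  -- the invariant of the rectified sequence at stage `k`: a contact parameter carrying `f` to level `k + 2`
  let Good : ℕ → S → Prop := fun k y =>
    y ∈ maximalIdeal S ∧ y ∉ maximalIdeal S ^ 2 ∧ f ∈ contactFiltration y (k + 2) ((k + 2) * ν)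
  have step : ∀ (k : ℕ) (y : S), Good k y → ∃ y' : S, Good (k + 1) y' ∧ y' - y ∈ maximalIdeal S ^ (k + 2) := by
    rintro k y ⟨hy, hy2, hfy⟩
    obtain ⟨g, hg, hg2, hfg⟩ := hall (k + 3)
    -- `g` also carries `f` to level `k + 2`; the key step of C2 gives `y ∈ (g) + 𝔪^{k+2}`
    have hfg' : f ∈ contactFiltration g (k + 2) ((k + 2) * ν) := contactFiltration_weight_anti g (by omega) ν hfg
    have hmem : y ∈ Ideal.span {g} ⊔ maximalIdeal S ^ (k + 2) :=
      ContactFiltration.mem_span_sup_pow_of_mem_contactFiltration hy hg hg2 (b := k + 2) (by omega) hν1 hford hfy hfg'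
    obtain ⟨a, ha, m', hm', hay⟩ := Submodule.mem_sup.mp hmem
    obtain ⟨c, rfl⟩ := Ideal.mem_span_singleton'.mp ha
    -- `c` is a unit since `y ∉ 𝔪²`
    have hc : IsUnit c := by
      by_contra hcu
      apply hy2
      rw [← hay]
      refine Ideal.add_mem _ ?_ (Ideal.pow_le_pow_right (by omega) hm')
      rw [pow_two]
      exact Ideal.mul_mem_mul ((IsLocalRing.mem_maximalIdeal _).mpr hcu) hg
    refine ⟨c * g, ⟨Ideal.mul_mem_left _ _ hg, ?_, ?_⟩, ?_⟩
    · intro h2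
      apply hy2
      rw [← hay]
      exact Ideal.add_mem _ h2 (Ideal.pow_le_pow_right (by omega) hm')
    · rw [contactFiltration_unit_mul hc]
      exact hfg
    · rw [← hay, sub_add_cancel_left, neg_mem_iff]
      exact hm'
  choose next hnext using step
  obtain ⟨g₀, hg₀, hg₀2, hfg₀⟩ := hall 2
  have hgood0 : Good 0 g₀ := ⟨hg₀, hg₀2, hfg₀⟩
  let seq : (k : ℕ) → {y : S // Good k y} := fun k =>
    Nat.rec (motive := fun k => {y : S // Good k y}) ⟨g₀, hgood0⟩ (fun k p => ⟨next k p.1 p.2, (hnext k p.1 p.2).1⟩) k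
  let y : ℕ → S := fun k => (seq k).1
  have hyg : ∀ k, Good k (y k) := fun k => (seq k).2
  have hstep : ∀ k, y (k + 1) - y k ∈ maximalIdeal S ^ (k + 2) := fun k => (hnext k (seq k).1 (seq k).2).2
  -- K6: termination of steepening
  obtain ⟨π, hπ, hπ2, hass⟩ := LocalGameEFTContact.exists_associated_pow_of_adicSteepening hS y
    (fun k => (hyg k).1) (fun k => (hyg k).2.1) (b := fun k => k + 2) (fun a b h => by simpa using h) hstep hν1 hford
    (fun k => contactFiltration_level_le_span_pow_sup_pow (y k) (k + 2) ν (hyg k).2.2)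
  -- hence `f` is of monomial type
  obtain ⟨u, hu⟩ := hass.symm
  exact hnm ⟨(u : S), π, ν, u.isUnit, hπ, hπ2, by rw [← hu, mul_comm]⟩

/-- **`b_max` IS ATTAINED AND POSITIVE** at a position (`0 ≠ f ∈ 𝔪²`) NOT of monomial type of an EXCELLENT regular local
ring (every dimension): `b = 1` is reached by any regular parameter, and the reached levels are bounded
(`bddAbove_reaches`, K6).  [Design note (R2): the planner sketch's hypothesis `ringKrullDim R = 2` is replaced by
excellence — K6 is dimension-free but needs excellence, and without it the statement fails.]
[OURS · L1 W4.3 · (o24-D)] -/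
theorem one_le_bMax_and_reaches (R : Type u) [CommRing R] [IsRegularLocalRing R] (hS : IsExcellentRing R) {f : R}
    (hf0 : f ≠ 0) (hf2 : f ∈ maximalIdeal R ^ 2) (hnm : ¬ IsMonomialType f) :
    1 ≤ bMax f ∧ Reaches f (adicOrder f).toNat (bMax f) := by
  have h𝔪 : maximalIdeal R ≠ ⊥ := by
    intro h
    apply hf0
    have : f ∈ maximalIdeal R := Ideal.pow_le_self two_ne_zero hf2
    rw [h] at this
    exact (Submodule.mem_bot R).mp this
  have hpar := exists_mem_maximalIdeal_not_mem_sq h𝔪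
  obtain ⟨ν, -, hνeq, -, hfmem, -⟩ := exists_adicOrder_eq_of_not_isMonomialType hf0 hnm hpar
  have hbdd := bddAbove_reaches hS hf0 hf2 hnm
  have h1 : (1 : ℕ) ∈ {b : ℕ | 1 ≤ b ∧ Reaches f (adicOrder f).toNat b} :=
    ⟨le_rfl, by rw [hνeq]; exact reaches_one hfmem hpar⟩
  exact Nat.sSup_mem ⟨1, h1⟩ hbdd

/-- Every reached level `b ≥ 1` is `≤ b_max` (excellent regular local ring, position not of monomial type).
[OURS · L1 W4.3 · (o24-D)] -/
theorem le_bMax_of_reaches (R : Type u) [CommRing R] [IsRegularLocalRing R] (hS : IsExcellentRing R) {f : R}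
    (hf0 : f ≠ 0) (hf2 : f ∈ maximalIdeal R ^ 2) (hnm : ¬ IsMonomialType f) {b : ℕ} (hb : 1 ≤ b)
    (h : Reaches f (adicOrder f).toNat b) : b ≤ bMax f :=
  le_csSup (bddAbove_reaches hS hf0 hf2 hnm) ⟨hb, h⟩

/-- **The level `b_max + 1` is NOT reached** (nor any higher level): the trigger of the CASE-B move of the
dimension-two table (res-type-098 (o24-G)). [OURS · L1 W4.3 · (o24-D)] -/
theorem not_reaches_of_bMax_lt (R : Type u) [CommRing R] [IsRegularLocalRing R] (hS : IsExcellentRing R) {f : R}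
    (hf0 : f ≠ 0) (hf2 : f ∈ maximalIdeal R ^ 2) (hnm : ¬ IsMonomialType f) {b : ℕ} (hb : bMax f < b) :
    ¬ Reaches f (adicOrder f).toNat b := fun h =>
  lt_irrefl _ (lt_of_lt_of_le hb (le_bMax_of_reaches R hS hf0 hf2 hnm (by omega) h))

/-- Per-parameter form of `not_reaches_of_bMax_lt` (078's `bMax_spec` request): NO contact parameter carries `f` to a
level above `b_max`. [OURS · L1 W4.3 · (o24-D)] -/
theorem not_mem_contactFiltration_of_bMax_lt (R : Type u) [CommRing R] [IsRegularLocalRing R] (hS : IsExcellentRing R)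
    {f : R} (hf0 : f ≠ 0) (hf2 : f ∈ maximalIdeal R ^ 2) (hnm : ¬ IsMonomialType f) {g : R} (hg : g ∈ maximalIdeal R)
    (hg' : g ∉ maximalIdeal R ^ 2) {b : ℕ} (hb : bMax f < b) :
    f ∉ contactFiltration g b (b * (adicOrder f).toNat) := fun h =>
  not_reaches_of_bMax_lt R hS hf0 hf2 hnm hb ⟨g, hg, hg', h⟩

/-- `one_le_bMax_and_reaches` for local rings ESSENTIALLY OF FINITE TYPE over a field (the binder of the door's positions;
such rings are excellent, tree `IsExcellentRing.of_essFiniteType`). [OURS · L1 W4.3 · (o24-D)] -/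
theorem one_le_bMax_and_reaches_of_essFiniteType (k₀ : Type u) [Field k₀] (R : Type u) [CommRing R]
    [IsRegularLocalRing R] [Algebra k₀ R] [Algebra.EssFiniteType k₀ R] {f : R} (hf0 : f ≠ 0)
    (hf2 : f ∈ maximalIdeal R ^ 2) (hnm : ¬ IsMonomialType f) :
    1 ≤ bMax f ∧ Reaches f (adicOrder f).toNat (bMax f) :=
  have hk : IsExcellentRing k₀ := Stacks07QW_field_holds k₀ k₀ inferInstance
  one_le_bMax_and_reaches R (hk.of_essFiniteType ‹_›) hf0 hf2 hnm

end Terminal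

end Summit.ResolutionOfSingularities.ResolutionOfSingularities.Cruxes.HypersurfaceCentreConstruction.LocalEngine

end
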